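import Mathlib
import Summits.Ventures.PercRepro2.CrossAPrimeFreeEdge
import Summits.Ventures.PercRepro2.CrossAPrimeTwoRoutesSameSupp
import Summits.Ventures.PercRepro2.CrossAPrimeMixtureAlgebraGen

/-!
# A two-route core plus one free `a₁`–`v` edge, same-route placement
(blind cell PercRepro2, p5 g36; S4 §2.4 (s) addendum 41)

`CrossAPrimeFreeEdge.crossA'so_nonneg_of_twoRoutes_freeEdge` for both marks on `π₁`: the masses
of `p` are the two-component mixture `(1 − q)·m(p[e ↦ 0]) + q·m_v̄(p[e ↦ 0])` (`prob_eq_pin` and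
the masses of `p[e ↦ 1]` from `CrossAPrimeFreeEdge`), the core is the same-route law on the
support (`CrossAPrimeTwoRoutesSameSupp`), and `CrossAPrimeMixtureAlgebraGen.mixture_nonneg'` with
`G = 0`, `κ₁ = κ₂ = p₂` closes: **`crossA'so_nonneg_of_twoRoutes_freeEdge_same`**.
Own work; standard axioms.
-/

namespace Summit.Ventures.PercRepro2

open LeafRowPendantRootSO CrossAPrimeA2Route CrossAPrimeSupport CrossAPrimeTwoRoutes
  CrossAPrimeTwoRoutesSupp CrossAPrimeAvoidCrux CrossAPrimeFreeEdge CrossAPrimeTwoRoutesSameSupp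
  CrossAPrimeMixtureAlgebraGen

namespace CrossAPrimeFreeEdgeSame

variable {V : Type*} {E : Type*} [Fintype E] [DecidableEq E] [Fintype V] [DecidableEq V]
  {R : Type*} [Field R] [LinearOrder R] [IsStrictOrderedRing R]
variable {ends : E → Sym2 V}

/-- **A two-route core plus one free `a₁`–`v` edge, both marks on `π₁`: the sign of `crossA′so`.** -/
theorem crossA'so_nonneg_of_twoRoutes_freeEdge_same (p : E → R) (hp : IsProbVec p)
    {π₁ π₂ : Finset E} {V₁ V₂ : Finset V} {o a₁ a₂ v b : V} {e : E}
    (he : ends e = s(a₁, v))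
    (hd : Disjoint π₁ π₂)
    (hπ₂ : ∀ e ∈ π₂, ∀ x, x ∈ ends e → x = a₁ ∨ x ∈ V₂)
    (hconn₁ : ∀ ω ∈ allOpen π₁, ∀ x ∈ V₁, Conn ends ω a₁ x)
    (hconn₂ : ∀ ω ∈ allOpen π₂, ∀ x ∈ V₂, Conn ends ω a₁ x)
    (hv₁ : v ∈ V₁) (hv₂ : v ∈ V₂) (ho : o ∈ V₁) (hb : b ∈ V₁)
    (hroute : ∀ ω ∈ supp (Function.update p e 0), ω ∈ avoidAll ends a₂ {a₁} →
      (ω ∈ connEvent ends a₁ v ↔ ω ∈ allOpen π₁ ∪ allOpen π₂)) :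
    0 ≤ crossA'so p ends o a₁ a₂ v b := by
  classical
  have hq₀ : IsProbVec (Function.update p e 0) := hp.update e le_rfl zero_le_one
  have hP₁0 : 0 ≤ ∏ e' ∈ π₁, Function.update p e 0 e' := Finset.prod_nonneg fun e _ => hq₀.nonneg e
  have hP₂0 : 0 ≤ ∏ e' ∈ π₂, Function.update p e 0 e' := Finset.prod_nonneg fun e _ => hq₀.nonneg e
  have hP₁1 : ∏ e' ∈ π₁, Function.update p e 0 e' ≤ 1 :=
    Finset.prod_le_one (fun e _ => hq₀.nonneg e) (fun e _ => hq₀.le_one e)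
  have hP₂1 : ∏ e' ∈ π₂, Function.update p e 0 e' ≤ 1 :=
    Finset.prod_le_one (fun e _ => hq₀.nonneg e) (fun e _ => hq₀.le_one e)
  have hC := const_le_pi p hp he hd hconn₁ hconn₂ hv₁ hv₂
  refine crossA'so_nonneg_of_crossC hp o a₁ a₂ v b hC ?_
  set Q := avoidAll ends a₂ {a₁} with hQ
  set Qv := avoidAll ends a₂ (insert a₁ {v}) with hQv
  set oH := connEvent ends a₂ o
  set bH := connEvent ends a₂ b
  set vH := connEvent ends a₂ v
  set L := connEvent ends a₁ v
  set P₁ := ∏ e' ∈ π₁, Function.update p e 0 e' with hP₁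
  set P₂ := ∏ e' ∈ π₂, Function.update p e 0 e' with hP₂
  -- the core facts
  have htwo := crossC_nonneg_of_twoRoutes_same_supp _ hq₀ hπ₂ hconn₁ hconn₂ ho hb hroute
  have hxv0 := prob_xv_le_supp _ hq₀ hπ₂ hconn₁ hconn₂ ho hv₂ hroute
  have hyv0 := prob_xv_le_supp _ hq₀ hπ₂ hconn₁ hconn₂ hb hv₂ hroute
  have hxveq := prob_xv_eq_supp _ hπ₂ hconn₁ hconn₂ ho hroute
  have hyveq := prob_xv_eq_supp _ hπ₂ hconn₁ hconn₂ hb hroute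
  have eu : Q ∩ oH ∩ vHᶜ = Qv ∩ oH := by rw [hQv, avoidAll_pair_eq, Set.inter_right_comm]
  have ew : Q ∩ bH ∩ vHᶜ = Qv ∩ bH := by rw [hQv, avoidAll_pair_eq, Set.inter_right_comm]
  rw [eu] at hxv0
  rw [ew] at hyv0
  -- the masses of `p[e ↦ 1]`
  obtain ⟨hx1, hxv1⟩ := prob_update_one_conn p he a₂ o
  obtain ⟨hy1, hyv1⟩ := prob_update_one_conn p he a₂ b
  have hZ1 := prob_update_one_Q p he a₂
  have hDv1 := prob_update_one_Dv p he a₂ o b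
  -- BHK with the avoidance of `{a₁, v}`
  have hbhk : prob (Function.update p e 0) (Qv ∩ oH) * prob (Function.update p e 0) (Qv ∩ bH) ≤
      prob (Function.update p e 0) (Qv ∩ (oH ∩ bH)) * prob (Function.update p e 0) Qv := by
    have key := bhk_same_cluster_events_avoid _ hq₀ ends a₂ (insert a₁ {v})
      (isUpperSet_mem_set (V := V) o) (isUpperSet_mem_set (V := V) b)
    rw [← connEvent_eq_clusterInEvent_mem, ← connEvent_eq_clusterInEvent_mem,
      ← connEvent_inter_eq_clusterInEvent_mem, Set.inter_comm (connEvent ends a₂ o),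
      Set.inter_comm (connEvent ends a₂ b), Set.inter_comm (connEvent ends a₂ o ∩ _)] at key
    exact key
  have hs : prob (Function.update p e 0) Qv ≤ prob (Function.update p e 0) Q := by
    refine prob_mono hq₀ fun ω h x hx => ?_
    rw [Finset.mem_singleton] at hx
    rw [hx]
    exact h a₁ (Finset.mem_insert_self a₁ {v})
  have hu : prob (Function.update p e 0) (Qv ∩ oH) ≤ prob (Function.update p e 0) (Q ∩ oH) := by
    refine prob_mono hq₀ fun ω h => ⟨fun x hx => ?_, h.2⟩
    rw [Finset.mem_singleton] at hx
    rw [hx]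
    exact h.1 a₁ (Finset.mem_insert_self a₁ {v})
  have hw : prob (Function.update p e 0) (Qv ∩ bH) ≤ prob (Function.update p e 0) (Q ∩ bH) := by
    refine prob_mono hq₀ fun ω h => ⟨fun x hx => ?_, h.2⟩
    rw [Finset.mem_singleton] at hx
    rw [hx]
    exact h.1 a₁ (Finset.mem_insert_self a₁ {v})
  -- route masses below `π̃ · x`
  have hP₂pit : P₂ ≤ P₁ + P₂ - P₁ * P₂ := by
    have := mul_nonneg hP₁0 (sub_nonneg.2 hP₂1)
    linarith
  have hxvπ : prob (Function.update p e 0) (Q ∩ (L ∩ oH)) ≤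
      (P₁ + P₂ - P₁ * P₂) * prob (Function.update p e 0) (Q ∩ oH) := by
    rw [hxveq]
    have h1 : prob (Function.update p e 0) (avoidAll ends a₂ (insert a₁ V₂) ∩ oH) ≤
        prob (Function.update p e 0) (Q ∩ oH) := by
      refine prob_mono hq₀ fun ω hω => ⟨fun x hx => ?_, hω.2⟩
      rw [Finset.mem_singleton] at hx
      rw [hx]
      exact hω.1 a₁ (Finset.mem_insert_self a₁ V₂)
    calc P₂ * _ ≤ P₂ * prob (Function.update p e 0) (Q ∩ oH) := mul_le_mul_of_nonneg_left h1 hP₂0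
      _ ≤ _ := mul_le_mul_of_nonneg_right hP₂pit (prob_nonneg hq₀ _)
  have hyvπ : prob (Function.update p e 0) (Q ∩ (L ∩ bH)) ≤
      (P₁ + P₂ - P₁ * P₂) * prob (Function.update p e 0) (Q ∩ bH) := by
    rw [hyveq]
    have h1 : prob (Function.update p e 0) (avoidAll ends a₂ (insert a₁ V₂) ∩ bH) ≤
        prob (Function.update p e 0) (Q ∩ bH) := by
      refine prob_mono hq₀ fun ω hω => ⟨fun x hx => ?_, hω.2⟩
      rw [Finset.mem_singleton] at hx
      rw [hx]
      exact hω.1 a₁ (Finset.mem_insert_self a₁ V₂)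
    calc P₂ * _ ≤ P₂ * prob (Function.update p e 0) (Q ∩ bH) := mul_le_mul_of_nonneg_left h1 hP₂0
      _ ≤ _ := mul_le_mul_of_nonneg_right hP₂pit (prob_nonneg hq₀ _)
  -- the core crux in the mixture lemma's form
  have htwo' : 0 ≤ 2 * prob (Function.update p e 0) Q *
        prob (Function.update p e 0) (Q ∩ (L ∩ (oH ∩ bH))) -
      prob (Function.update p e 0) (Q ∩ bH) * prob (Function.update p e 0) (Q ∩ (L ∩ oH)) -
      prob (Function.update p e 0) (Q ∩ oH) * prob (Function.update p e 0) (Q ∩ (L ∩ bH)) +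
      (P₁ + P₂ - P₁ * P₂) * prob (Function.update p e 0) (Q ∩ oH) *
        prob (Function.update p e 0) (Q ∩ bH) := by
    unfold crossC at htwo
    linarith
  have hκ : P₂ + P₂ ≤ 2 * (P₁ + P₂ - P₁ * P₂) := by linarith
  -- the weights
  set q := p e with hq
  have hq0 : 0 ≤ q := hp.nonneg e
  have hq1 : q ≤ 1 := hp.le_one e
  have hweight : (1 - (q + (1 - q) * (P₁ + P₂ - P₁ * P₂))) * q ≤
      ((q + (1 - q) * (P₁ + P₂ - P₁ * P₂)) - (P₁ + P₂ - P₁ * P₂)) * (1 - q) := by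
    have : (1 - (q + (1 - q) * (P₁ + P₂ - P₁ * P₂))) * q =
        ((q + (1 - q) * (P₁ + P₂ - P₁ * P₂)) - (P₁ + P₂ - P₁ * P₂)) * (1 - q) := by ring
    rw [this]
  have hCpit : P₁ + P₂ - P₁ * P₂ ≤ q + (1 - q) * (P₁ + P₂ - P₁ * P₂) := by
    have hpit1 : P₁ + P₂ - P₁ * P₂ ≤ 1 := by
      have := mul_nonneg (sub_nonneg.2 hP₁1) (sub_nonneg.2 hP₂1)
      linarith
    have := mul_nonneg hq0 (sub_nonneg.2 hpit1)
    linarith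
  have hmix := mixture_nonneg' (G := 0) (Zon := 0) (xon := 0) (yon := 0) (κ₁ := P₂) (κ₂ := P₂)
    (sub_nonneg.2 hq1) le_rfl hq0 hP₁0 hP₁1 hP₂0 hCpit hweight (prob_nonneg hq₀ Qv) hs
    (prob_nonneg hq₀ (Qv ∩ oH)) (prob_nonneg hq₀ (Qv ∩ bH)) (prob_nonneg hq₀ (Qv ∩ (oH ∩ bH)))
    (prob_nonneg hq₀ (Q ∩ (L ∩ (oH ∩ bH)))) hu hw hκ hxv0 hyv0 hxvπ hyvπ hbhk htwo' le_rfl le_rfl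
    le_rfl
  -- the masses of `p` as the mixture
  have hZ := prob_eq_pin p Q e
  have hx := prob_eq_pin p (Q ∩ oH) e
  have hy := prob_eq_pin p (Q ∩ bH) e
  have hxv := prob_eq_pin p (Q ∩ (L ∩ oH)) e
  have hyv := prob_eq_pin p (Q ∩ (L ∩ bH)) e
  have hDv := prob_eq_pin p (Q ∩ (L ∩ (oH ∩ bH))) e
  rw [hZ1] at hZ
  rw [hx1] at hx
  rw [hy1] at hy
  rw [hxv1] at hxv
  rw [hyv1] at hyv
  rw [hDv1] at hDv
  unfold crossC
  rw [hZ, hx, hy, hxv, hyv, hDv]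
  linarith [hmix]

end CrossAPrimeFreeEdgeSame

end Summit.Ventures.PercRepro2
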